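import Literature.IUT.HodgeTheaters.PiAvatarOuterHom
import Literature.IUT.HodgeTheaters.PiAvatarBaseKitNF
import Literature.IUT.HodgeTheaters.KitNFSideEval
import HarnessLib

/-!
# Example 4.4's EVALUATION SECTIONS at `v̲ ∈ V̲^bad` as a binder over a local datum, their OUTER classes `φ^Θ_{v̲_j} = [s_j ∘ (Π_v̲ ↠ G_v̲)]`, and the
# Θ-side bad-place kit in the outer hom-type `MultKitTheta` NEXT TO abc-iut-L5-t4's frozen `MultKit` (junction J-Θ-1, design decision D-JΘ1-1 (iv-c);
# one binder structure + defs — post-freeze additive D13, content AFTER-MERGE (L3), not a cone member)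

S. Mochizuki, *Inter-universal Teichmüller theory I*, kurims manuscript (May 2020), Ex 4.4 (i) p. 106 l. 22–34 («the various sections `G_v → Π_v = Π^tp_{X̳_v}` of the
natural surjection `Π_v ↠ G_v` that arise from the evaluation points … each evaluation section has an associated label `∈ |𝔽_l|` … a group-theoretic algorithm for
constructing the evaluation sections … [EtTh], Corollary 2.9 [the group-theoreticity of the labels]; [EtTh], Proposition 2.4 …; [SemiAnbd], Corollary 3.11 …;
[SemiAnbd], Theorem 6.8, (iii) [the decomposition groups of `μ_−`-translates of the cusps]»), p. 107 l. 1–5 («the various morphisms `ℬ^temp(Π_v̲)⁰ → ℬ^temp(Π_v̲)⁰`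
that arise [i.e., via composition with the natural surjection `Π_v̲ ↠ G_v̲`] from the evaluation sections labeled `j`»), (ii) p. 107 («composing with arbitrary
isomorphisms»), (iv) p. 107 (labels well defined), Prop 6.7 p. 167 ([IUTchI] Ex 4.4 (i) p.106) [claim: Mochizuki2012, status: disputed] (D-0012 claim key, series
status DISPUTED — ONE interface binder + definitions over abc-iut-L5-t2's REAL `InitialThetaData` and abc-iut-L5-t4's `LocalDatum`; the binder ABSTRACTS
[EtTh] Prop 1.4 (ii), Def 2.5 (i), Prop 2.4, Cor 2.9 and [SemiAnbd] Cor 3.11, Thm 6.8 (iii) — content after-merge (L3), never asserted; no side is taken on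
[IUTchIII] Cor. 3.12).

WHY (L5-lead RULINGS #82 (1), file (B) of the J-Θ-1 repair; kernel-obstruction theorems = abc-iut-w4-d054's `PiAvatarThetaBridgeObstruction.lean`, cited BY NAME).
In the Π-avatar the morphisms of `Amb v` are coset maps (injective-type), so Example 4.4's `φ^Θ_{v̲_j} = s_j ∘ aug` cannot be morphisms of `Amb v` (J-Θ-1).  Here,
in the OUTER hom-type of `PiAvatarOuterHom` (p455871): **`EvalSections δ Gv`** (DATA: `|𝔽_l|`-indexed sections `s_j : G_v̲ → Π_{C_F}` of `aug` landing in `Π_v̲`;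
the zero label is the index `0 ∈ |𝔽_l|`), **`evalHom j = s_j ∘ aug|_{Π_v̲}`** (kills `Π_v̲ ∩ Ker aug` — NON-injective whenever `Δ_v̲ ≠ 1`), its outer class **`evalOuter j`**
(over `G_F`), the two-sided `Aut(𝒟_v̲)`-saturated class **`thetaClass j`** (Ex 4.4 (ii)), the LAW **`LabelRigid`** (Ex 4.4 (iv) / [EtTh] Cor 2.9) and the binder
**`EvalSectionBinder := EvalSections + label_rigid`**; then **`MultKitTheta δ bad`** (the Θ-side bad-place classes IN THE OUTER HOM-TYPE, next to t4's frozen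
`MultKit.thetaPolyBad`), the forgetful **`MultKit.toTheta`** from any multiplicative kit of a Π-avatar NF-widened kit (`OrbitCat.toOuter` on coset classes),
**`MultKitTheta.ofEvalSections`** (`thetaPolyBadOuter j := thetaClass [j]`) and the (γ)-analogue **`ThetaAgreesOuter`**, a THEOREM at `ofEvalSections` (`rfl`).
Tags of record (RULINGS #79 (2)(a), #84): every `Mk`/`E`/`Z` binder at a Π-avatar kit is «[Θ-side stand-in; J-Θ-1]», and the Π-avatar `EvalBinder`/`KitCore` route
(abc-iut-L5-t3 p452433/p453062) is VACUOUS at CLOSED `Π_v̲` — abc-iut-w4-d054's `PiAvatarKitCoreObstruction.lean` (p456090: closed `H`, `a⁻¹Ha ≤ H ⇒ a ∈ N(H)`, so no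
label-rigid `EvalBinder` of coset maps exists); THIS module is the NON-vacuous typing: `EvalSections` is a BINDER of genuine SECTIONS (L3 content; NV at the semidirect
models = row «EVALSECT-NV»), and its classes live in the outer hom-type where non-injective morphisms exist. No instance, no notation; typed ≠ inhabited ≠ proved; binder ≠ fact.
-/

noncomputable section

namespace Literature.IUT.HodgeTheaters

open CategoryTheory

universe u v w

section EvalSections

variable {F : Type u} {K : Type v} {Fbar : Type w} [Field F] [NumberField F] [Field K] [NumberField K]
  [Algebra F K] [Field Fbar] [Algebra F Fbar] [Algebra K Fbar]
  {E : WeierstrassCurve F} [E.IsElliptic] {l : ℕ} {Pb : BadPlacePredicates K}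
  {D : InitialThetaData F K Fbar E l Pb} {CG : D.geom.pe.CuspGalois} {hS : D.CuspClassesNormaliserStable} [Fact l.Prime]

namespace InitialThetaData

/-! ### The evaluation-section DATA of a local datum at a bad place -/

/-- **Example 4.4 (i)'s EVALUATION SECTIONS at `v̲ ∈ V̲^bad` (DATA binder over a local datum `Π_v̲ = δ.H` lying over `G_v̲`)**: for each label `j ∈ |𝔽_l|` a
section `s_j : G_v̲ → Π_{C_F}` of the augmentation with values in `Π_v̲` («the various sections `G_v → Π_v` of the natural surjection `Π_v ↠ G_v` that arise from the
evaluation points … each evaluation section has an associated label `∈ |𝔽_l|`»; abstracts [EtTh] Prop 1.4 (ii), Def 2.5 (i), [SemiAnbd] Thm 6.8 (iii) — content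
after-merge). ([IUTchI] Ex 4.4 (i) p.106) [claim: Mochizuki2012, status: disputed] -/
structure EvalSections (δ : D.LocalDatum CG hS) (Gv : Subgroup (Fbar ≃ₐ[F] Fbar)) : Type w where
  /-- the section labelled `j` -/
  sect : FlAbs l → (↥Gv →* D.PiC)
  /-- its values lie in `Π_v̲` -/
  sect_mem : ∀ j g, sect j g ∈ δ.H
  /-- it is a section of the augmentation `Π_{C_F} ↠ G_F` -/
  aug_sect : ∀ j (g : ↥Gv), D.augGF (sect j g) = g
  /-- `Π_v̲` lies over `G_v̲` (Def 3.1 (e): «natural outer surjections onto the decomposition group `G_v̲`») -/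
  aug_mem : ∀ x ∈ δ.H, D.augGF x ∈ Gv

namespace EvalSections

variable {δ : D.LocalDatum CG hS} {Gv : Subgroup (Fbar ≃ₐ[F] Fbar)} (ES : EvalSections δ Gv)

/-- `aug|_{Π_v̲} : Π_v̲ → G_v̲`. ([IUTchI] Def 3.1 (e) p.62) [claim: Mochizuki2012, status: disputed] -/
def augH : ↥δ.H →* ↥Gv := (D.augGF.comp δ.H.subtype).codRestrict Gv fun x => ES.aug_mem x x.2

/-- `s_j` with values in `Π_v̲`. ([IUTchI] Ex 4.4 (i) p.106) [claim: Mochizuki2012, status: disputed] -/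
def sectH (j : FlAbs l) : ↥Gv →* ↥δ.H := (ES.sect j).codRestrict δ.H (ES.sect_mem j)

/-- **`φ^Θ_{v̲_j}` as a homomorphism: `s_j ∘ aug|_{Π_v̲} : Π_v̲ → Π_v̲`** («via composition with the natural surjection `Π_v̲ ↠ G_v̲`»).
([IUTchI] Ex 4.4 (i) p.107) [claim: Mochizuki2012, status: disputed] -/
def evalHom (j : FlAbs l) : ↥δ.H →* ↥δ.H := (ES.sectH j).comp ES.augH

/-- `evalHom j x = s_j (aug x)`. ([IUTchI] Ex 4.4 (i) p.107) [claim: Mochizuki2012, status: disputed] -/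
theorem coe_evalHom (j : FlAbs l) (x : ↥δ.H) : (ES.evalHom j x : D.PiC) = ES.sect j ⟨D.augGF x, ES.aug_mem x x.2⟩ := rfl

/-- **`φ^Θ_{v̲_j}` KILLS `Π_v̲ ∩ Ker(aug)`** (the geometric part): it is NOT injective as soon as `Π_v̲` meets `Δ` non-trivially — the reason it is no morphism of the
orbit category (J-Θ-1; abc-iut-w4-d054's obstruction file). ([IUTchI] Ex 4.4 (i) p.107) [claim: Mochizuki2012, status: disputed] -/
theorem evalHom_eq_one_of_aug_eq_one (j : FlAbs l) {x : ↥δ.H} (hx : D.augGF x = 1) : ES.evalHom j x = 1 := by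
  apply Subtype.ext
  rw [coe_evalHom, Subgroup.coe_one]
  have h1 : (⟨D.augGF x, ES.aug_mem x x.2⟩ : ↥Gv) = 1 := Subtype.ext hx
  rw [h1, map_one]

/-- **The OUTER class `φ^Θ_{v̲_j} = [s_j ∘ aug]`** — a morphism `𝒟_v̲ → 𝒟_v̲` in the outer hom-type. ([IUTchI] Ex 4.4 (i) p.107) [claim: Mochizuki2012, status: disputed] -/
def evalOuter (j : FlAbs l) : OuterHom δ.H δ.H := OuterHom.ofHom (ES.evalHom j)

/-- `φ^Θ_{v̲_j}` lies over `G_F` (with `g = 1`): a morphism of the adopted shape. ([IUTchI] Ex 4.4 (i) p.107) [claim: Mochizuki2012, status: disputed] -/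
theorem isOver_evalOuter (j : FlAbs l) : (ES.evalOuter j).IsOver D.augGF := by
  rw [evalOuter, OuterHom.isOver_ofHom_iff]
  exact ⟨1, fun x => by rw [coe_evalHom, ES.aug_sect]; simp⟩

/-! ### Example 4.4 (ii)'s classes and the label-rigidity LAW -/

/-- (L1)-type bookkeeping: an element normalising `Π_v̲` conjugates `Π_v̲` into itself. ([IUTchI] Def 6.1 (iii) p.157) [claim: Mochizuki2012, status: disputed] -/
theorem conj_mem_of_mem_normalizer {n : D.PiC} (hn : n ∈ Subgroup.normalizer ((δ.H : Subgroup D.PiC) : Set D.PiC)) :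
    ∀ x ∈ δ.H, n⁻¹ * x * n ∈ δ.H := fun x hx => by
  have h := (Subgroup.mem_normalizer_iff.mp (Subgroup.inv_mem _ hn) x).mp hx
  simpa using h

/-- **The class `φ^Θ_{v̲_j}` of label `j` (Ex 4.4 (ii): «composing with arbitrary isomorphisms»)**: all two-sided composites `α ≫ [s_j ∘ aug] ≫ β` with
automorphisms `α`, `β` of `𝒟_v̲` (outer classes of coset automorphisms `xΠ_v̲ ↦ xnΠ_v̲`). ([IUTchI] Ex 4.4 (ii) p.107) [claim: Mochizuki2012, status: disputed] -/
def thetaClass (j : FlAbs l) : Set (OuterHom δ.H δ.H) :=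
  {f | ∃ (n m : D.PiC) (hn : n ∈ Subgroup.normalizer ((δ.H : Subgroup D.PiC) : Set D.PiC))
      (hm : m ∈ Subgroup.normalizer ((δ.H : Subgroup D.PiC) : Set D.PiC)),
      f = ((OuterHom.ofConj n (conj_mem_of_mem_normalizer hn)).comp (ES.evalOuter j)).comp
        (OuterHom.ofConj m (conj_mem_of_mem_normalizer hm))}

/-- Every class is nonempty: `φ^Θ_{v̲_j}` itself (`n = m = 1`). ([IUTchI] Ex 4.4 (i) p.107) [claim: Mochizuki2012, status: disputed] -/
theorem evalOuter_mem_thetaClass (j : FlAbs l) : ES.evalOuter j ∈ ES.thetaClass j := by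
  refine ⟨1, 1, Subgroup.one_mem _, Subgroup.one_mem _, ?_⟩
  rw [OuterHom.ofConj_one, OuterHom.id_comp, OuterHom.comp_id]

/-- **LAW (Ex 4.4 (iv) / [EtTh] Cor 2.9 «group-theoreticity of the labels») — LABEL RIGIDITY as a predicate**: distinct labels have DISJOINT classes (the label of
a `φ^Θ`-type morphism is well defined under two-sided composition with automorphisms of `𝒟_v̲`, Rmk 4.2.1). Named, never asserted.
([IUTchI] Ex 4.4 (iv) p.107) [claim: Mochizuki2012, status: disputed] -/
def LabelRigid : Prop := ∀ j j' : FlAbs l, (ES.thetaClass j ∩ ES.thetaClass j').Nonempty → j = j'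

end EvalSections

/-- **THE EVALUATION-SECTION BINDER** of a bad place: Example 4.4 (i)'s sections (DATA) + (iv)'s label rigidity (LAW). «[Θ-side binder at a Π-avatar local datum;
content after-merge L3: [EtTh] 1.4 (ii), 2.5 (i), 2.4, 2.9; [SemiAnbd] 3.11, 6.8 (iii)]». ([IUTchI] Ex 4.4 (i) p.106) [claim: Mochizuki2012, status: disputed] -/
structure EvalSectionBinder (δ : D.LocalDatum CG hS) (Gv : Subgroup (Fbar ≃ₐ[F] Fbar)) extends EvalSections δ Gv where
  /-- Ex 4.4 (iv): labels are rigid -/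
  label_rigid : toEvalSections.LabelRigid

/-! ### The Θ-side bad-place kit in the OUTER hom-type, next to abc-iut-L5-t4's frozen `MultKit` -/

variable {V : Type} (δ : V → D.LocalDatum CG hS) (bad : Finset V)

/-- **`MultKitTheta` — the model poly-morphisms `φ^Θ_{v̲_j}` at the bad indices IN THE OUTER HOM-TYPE** (twin of the bad-place field `MultKit.thetaPolyBad` of
abc-iut-L5-t4's PMBaseProcessions, which is typed in `Amb v`'s coset maps and stays FROZEN). ([IUTchI] Prop 6.7 p.167) [claim: Mochizuki2012, status: disputed] -/
structure MultKitTheta : Type w where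
  /-- `φ^Θ_{v̲_j}`, `j ∈ 𝔽_l^⋇ = {1, …, l^⋇}`, as a set of outer homomorphisms `𝒟_v̲ → 𝒟_v̲` -/
  thetaPolyBadOuter : ∀ (_j : Fin (lStar l)) (v : V), v ∈ bad → Set (OuterHom (δ v).H (δ v).H)

variable {δ bad}

/-- **The forgetful comparison `MultKit → MultKitTheta`** over a Π-avatar NF-widened kit: a coset class `xΠ_v̲ ↦ xdΠ_v̲` ↦ its conjugation class
(`OrbitCat.toOuter`) — every existing Π-avatar inhabitant maps in (and lands among INJECTIVE-type classes only, J-Θ-1).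
([IUTchI] Prop 6.7 p.167) [claim: Mochizuki2012, status: disputed] -/
def MultKit.toTheta [DecidableEq V] [(D.PiXund.subgroupOf D.PiXK).Normal] {hsurj : Function.Surjective D.toFlStarGlobal} {arc : Finset V}
    (Mk : (D.baseKitNFOfData CG hS hsurj bad arc δ).MultKit) : MultKitTheta δ bad where
  thetaPolyBadOuter j v hv := (fun f => OrbitCat.toOuter f.hom) '' Mk.thetaPolyBad j v hv

/-- **`MultKitTheta.ofEvalSections` — the Θ-side bad-place kit GENERATED BY EVALUATION SECTIONS**: `φ^Θ_{v̲_j} := thetaClass [j]` (the printed shape, modulo the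
binders `ES v`). ([IUTchI] Ex 4.4 (i) p.107) [claim: Mochizuki2012, status: disputed] -/
def MultKitTheta.ofEvalSections {Gv : V → Subgroup (Fbar ≃ₐ[F] Fbar)} (ES : ∀ v, v ∈ bad → EvalSectionBinder (δ v) (Gv v)) : MultKitTheta δ bad where
  thetaPolyBadOuter j v hv := (ES v hv).thetaClass (FlStar.toFlAbs l (FlStar.ofFin l j))

/-- **(γ)-outer `ThetaAgreesOuter`** (Prop 6.7: the kit's `φ^Θ_{v̲_j}` ARE Example 4.4's classes), in the outer hom-type: the Θ-side kit's classes are the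
evaluation-section classes of the given labels. ([IUTchI] Prop 6.7 p.167) [claim: Mochizuki2012, status: disputed] -/
def ThetaAgreesOuter {Gv : V → Subgroup (Fbar ≃ₐ[F] Fbar)} (MΘ : MultKitTheta δ bad) (ES : ∀ v, v ∈ bad → EvalSectionBinder (δ v) (Gv v)) : Prop :=
  ∀ (j : Fin (lStar l)) (v : V) (hv : v ∈ bad), MΘ.thetaPolyBadOuter j v hv = (ES v hv).thetaClass (FlStar.toFlAbs l (FlStar.ofFin l j))

/-- `ThetaAgreesOuter` HOLDS at the kit generated by the sections (by construction). ([IUTchI] Prop 6.7 p.167) [claim: Mochizuki2012, status: disputed] -/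
theorem thetaAgreesOuter_ofEvalSections {Gv : V → Subgroup (Fbar ≃ₐ[F] Fbar)} (ES : ∀ v, v ∈ bad → EvalSectionBinder (δ v) (Gv v)) :
    ThetaAgreesOuter (MultKitTheta.ofEvalSections ES) ES := fun _ _ _ => rfl

/-- Every class of the section-generated kit is NONEMPTY (Ex 4.4 (i): every label occurs). ([IUTchI] Ex 4.4 (i) p.107) [claim: Mochizuki2012, status: disputed] -/
theorem thetaPolyBadOuter_ofEvalSections_nonempty {Gv : V → Subgroup (Fbar ≃ₐ[F] Fbar)} (ES : ∀ v, v ∈ bad → EvalSectionBinder (δ v) (Gv v))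
    (j : Fin (lStar l)) (v : V) (hv : v ∈ bad) : ((MultKitTheta.ofEvalSections ES).thetaPolyBadOuter j v hv).Nonempty :=
  ⟨_, (ES v hv).evalOuter_mem_thetaClass _⟩

/-- **Label rigidity of the section-generated kit**: distinct nonzero labels have disjoint classes (from the binder's `label_rigid` and the injectivity of
`𝔽_l^⋇ → |𝔽_l|`). ([IUTchI] Ex 4.4 (iv) p.107) [claim: Mochizuki2012, status: disputed] -/
theorem thetaPolyBadOuter_ofEvalSections_disjoint {Gv : V → Subgroup (Fbar ≃ₐ[F] Fbar)} (ES : ∀ v, v ∈ bad → EvalSectionBinder (δ v) (Gv v))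
    (hl : l ≠ 2) {j j' : Fin (lStar l)} (v : V) (hv : v ∈ bad)
    (h : ((MultKitTheta.ofEvalSections ES).thetaPolyBadOuter j v hv ∩ (MultKitTheta.ofEvalSections ES).thetaPolyBadOuter j' v hv).Nonempty) :
    j = j' := by
  have h1 := (ES v hv).label_rigid _ _ h
  exact (FlStar.ofFin_bijective l hl).1 (FlStar.toFlAbs_injective l h1)

end InitialThetaData

end EvalSections

end Literature.IUT.HodgeTheaters
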